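import Literature.NumberTheory.Automorphic.AutomorphicQuotientKernelCompact
import HarnessLib

/-!
# Composition of kernels and the trace as an integral over the diagonal:
`∫_X K_{f₁}(x, z) K_{f₂}(z, y) dμ(z) = c K_{f₁ ⋆ f₂}(x, y)` and
`Σ_i ‖R(f) e_i‖² = c⁻¹ ∫_X K_{f ⋆ f^*}(x, x) dμ(x)`
(Gelbart, *Automorphic forms on adele groups* (1975), (9.3), (9.7), (9.11): "tr R(f) =
∫_{Γ\G} K(x, x) dx … at least when `f` is of the form `f₁ * f₂`"; Lemma 10.6, (10.10))

Topic `NumberTheory/Automorphic`; continuation of `AutomorphicQuotientKernel` /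
`AutomorphicQuotientKernelCompact` (theorems and two auxiliary definitions: the multiplicative
convolution `mulConv ν f₁ f₂ = ∫ f₁(u) f₂(u⁻¹ ·) dν(u)` and the involution
`mulStar f = \overline{f((·)⁻¹)}`; no named fact, no instance visible to importers).

Third layer of the inline (D-0026) decomposition of the named fact
`Literature.NumberTheory.Automorphic.strong_multiplicity_one_quaternionUnits` (Gelbart (1975),
Thm. 10.5 (ii), proved in the source by comparing `tr R(f * f^*)` (Lemma 10.6, (10.10)) on the
compact quotient of `G' = D^×` — the simple trace formula (10.14) = Remark 9.23 — with `GL₂`).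
The first two layers realised `R(f)` on `L²(G ⧸ H)` as the integral operator with the continuous
kernel `c⁻¹ K_f`, `K_f(x̃, ỹH) = ∫_H f(x̃ h⁻¹ ỹ⁻¹) dρ(h)`, and computed its Hilbert–Schmidt norm
`Σ_i ‖R(f) e_i‖² = c⁻² ∬ |K_f|²` on a compact quotient. Here, for `G` and `H` unimodular
(`ν` an inversion-invariant Haar measure on `G`; `ρ` a two-sided and inversion-invariant Haar
measure on the closed subgroup `H` — for `H = A_G · G(K)` this is
`AdelicGroupDataQuotientUnimodular`) and a compact quotient `X = G ⧸ H`: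

* `mulStar`, `mulConv` with `continuous_mulStar`, `hasCompactSupport_mulStar`,
  `continuous_mulConv`, `hasCompactSupport_mulConv` (`C_c(G)` is closed under `⋆` and `^*`);
* `integral_cosetKernel_mul_quotientKernel` — **composition of kernels**:
  `∫_X K_{f₁}(x̃, z) K_{f₂}(z, y) dμ(z) = c • K_{f₁ ⋆ f₂}(x̃, y)` for `f₁, f₂ ∈ C_c(G)` (the kernel
  formula of the first layer applied to `φ = K_{f₂}(·, y)`, then Fubini on `G × H`,
  `integrable_mul_comp_conj`); this is the kernel form of `R(f₁) R(f₂) = R(f₁ ⋆ f₂)`;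
* `quotientKernel_mulStar` — `K_{f^*}(z, y) = \overline{K_f(y, z)}`;
* `integral_integral_norm_sq_quotientKernel` — hence
  `∬ |K_f(x, y)|² dμ dμ = c ∫_X K_{f ⋆ f^*}(x, x) dμ(x)`;
* `AdelicGroupData.hasSum_norm_sq_integratedOperator_rightRegular_eq_diagonal` — for an adelic
  group datum with compact automorphic quotient (as in the second layer):
  **`Σ_i ‖R(f) e_i‖² = c⁻¹ ∫_X K_{f ⋆ f^*}(x, x) dμ(x)`** for every countable Hilbert basis of
  `L²(X, μ)` — Gelbart's (9.11) `tr R(f * f^*) = ∫ K_{f * f^*}(x, x) dx` in the form that needs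
  no trace-class theory, i.e. the left-hand side of the simple trace formula (10.14) for
  `Φ = f ⋆ f^*`, ready for the rearrangement of `∫_X K_Φ(x, x) dμ` by conjugacy classes
  (Gelbart (9.13), Remark 9.23 — the next layer).

## Design notes

* Conventions as in the first two layers (left cosets `G ⧸ H`, left action, `K_f` as there).
  With Gelbart's normalisation (`c = 1`, `Γ \ G`, right translation) the statements read
  `∫ K_{f₁}(x, z) K_{f₂}(z, y) dz = K_{f₁ * f₂}(x, y)` and `tr R(f f^*) = ∫ K_{f f^*}(x, x) dx`.
* `[ρ.IsInvInvariant]` (needed to turn `∫_H \overline{f(ỹ h z̃⁻¹)} dρ(h)` into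
  `\overline{K_f(ỹ, z̃H)}`) is assumed separately from two-sided invariance; for a Haar measure on
  a second countable group it follows from right invariance
  (`GLnIwasawaIntegration.isInvInvariant_of_isMulRightInvariant`).

## References

* S. Gelbart, *Automorphic forms on adele groups*, Ann. of Math. Studies 83 (1975), §9 (9.3),
  (9.7), (9.11)–(9.13), Remark 9.23; §10 Lemma 10.6, (10.10), (10.14) [Gelbart1975].
* D. Bump, *Automorphic Forms and Representations* (1997), §2.3, Prop. 2.3.1 [Bump1997].
-/

noncomputable section

open MeasureTheory Measure Set Filter Topology CompactlySupported
open Literature.MeasureTheory.Group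
open scoped ENNReal NNReal Pointwise

namespace Literature.NumberTheory.Automorphic

-- the coset space carries the Borel σ-algebra supplied by the user, not the quotient σ-algebra
attribute [-instance] Quotient.instMeasurableSpace QuotientGroup.measurableSpace

/-! ### The involution `f ↦ f^*` and multiplicative convolution on `C_c(G)` -/

section Star

variable {G : Type*} [Group G] {𝕜 : Type*} [RCLike 𝕜]

/-- The **involution** `f^*(g) = \overline{f(g⁻¹)}` (Gelbart (1975), Lemma 10.6: the operation
`f(g) → f^*(g) = \overline{f(g^{-1})}` under which `π(f * f^*) = π(f) π(f)^*`).
[cite: Gelbart1975, Lemma 10.6] -/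
def mulStar (f : G → 𝕜) (g : G) : 𝕜 := starRingEnd 𝕜 (f g⁻¹)

/-- `mulStar f g = conj (f g⁻¹)` (definitional). [folklore] -/
@[simp]
theorem mulStar_apply (f : G → 𝕜) (g : G) : mulStar f g = starRingEnd 𝕜 (f g⁻¹) := rfl

/-- `f^*` is continuous for continuous `f`. [folklore] -/
theorem continuous_mulStar [TopologicalSpace G] [ContinuousInv G] {f : G → 𝕜} (hf : Continuous f) :
    Continuous (mulStar f) :=
  RCLike.continuous_conj.comp (hf.comp continuous_inv)

/-- `f^*` is compactly supported for compactly supported `f` (its support is `(supp f)⁻¹`).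
[folklore] -/
theorem hasCompactSupport_mulStar [TopologicalSpace G] [IsTopologicalGroup G] {f : G → 𝕜}
    (hfs : HasCompactSupport f) : HasCompactSupport (mulStar f) := by
  have h1 : HasCompactSupport fun g : G => f g⁻¹ := hfs.comp_homeomorph (Homeomorph.inv G)
  rw [hasCompactSupport_def] at h1 ⊢
  refine h1.of_isClosed_subset isClosed_closure (closure_mono fun g hg => ?_)
  rw [Function.mem_support] at hg ⊢
  intro h0
  apply hg
  change starRingEnd 𝕜 (f g⁻¹) = 0
  rw [h0, map_zero]

end Star

section Convolution

variable {G : Type*} [Group G] [MeasurableSpace G] {𝕜 : Type*} [RCLike 𝕜]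

/-- The **convolution** `(f₁ ⋆ f₂)(g) = ∫_G f₁(u) f₂(u⁻¹ g) dν(u)` of two scalar functions on a
group with respect to a measure `ν` (a Haar measure in applications; Gelbart (1975), §1 / §9:
`R(f₁ * f₂) = R(f₁) R(f₂)`; Mathlib's `MeasureTheory.convolution` is additive only). [folklore] -/
def mulConv (ν : Measure G) (f₁ f₂ : G → 𝕜) (g : G) : 𝕜 := ∫ u, f₁ u * f₂ (u⁻¹ * g) ∂ν

/-- `mulConv ν f₁ f₂ g = ∫ f₁(u) f₂(u⁻¹ g) dν(u)` (definitional). [folklore] -/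
theorem mulConv_apply (ν : Measure G) (f₁ f₂ : G → 𝕜) (g : G) :
    mulConv ν f₁ f₂ g = ∫ u, f₁ u * f₂ (u⁻¹ * g) ∂ν := rfl

variable [TopologicalSpace G] [IsTopologicalGroup G] (ν : Measure G)

/-- **The convolution of two compactly supported functions is compactly supported** (its support
lies in `supp f₁ · supp f₂`). [folklore] -/
theorem hasCompactSupport_mulConv {f₁ f₂ : G → 𝕜} (hfs₁ : HasCompactSupport f₁)
    (hfs₂ : HasCompactSupport f₂) : HasCompactSupport (mulConv ν f₁ f₂) := by
  refine HasCompactSupport.intro (hfs₁.isCompact.mul hfs₂.isCompact) fun g hg => ?_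
  rw [mulConv_apply]
  refine integral_eq_zero_of_ae (Eventually.of_forall fun u => ?_)
  by_cases hu : u ∈ tsupport f₁
  · have hu2 : u⁻¹ * g ∉ tsupport f₂ := by
      intro h2
      exact hg ⟨u, hu, u⁻¹ * g, h2, mul_inv_cancel_left u g⟩
    change f₁ u * f₂ (u⁻¹ * g) = 0
    rw [image_eq_zero_of_notMem_tsupport hu2, mul_zero]
  · change f₁ u * f₂ (u⁻¹ * g) = 0
    rw [image_eq_zero_of_notMem_tsupport hu, zero_mul]

variable [BorelSpace G] [LocallyCompactSpace G] [SecondCountableTopology G]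
  [IsFiniteMeasureOnCompacts ν]

/-- **The convolution of two functions of `C_c(G)` is continuous** (parametric integral of the
jointly continuous `(g, u) ↦ f₁(u) f₂(u⁻¹ g)` over the compact `supp f₁`). [folklore] -/
theorem continuous_mulConv {f₁ f₂ : G → 𝕜} (hf₁ : Continuous f₁) (hfs₁ : HasCompactSupport f₁)
    (hf₂ : Continuous f₂) : Continuous (mulConv ν f₁ f₂) := by
  have hFc : Continuous (Function.uncurry fun (g : G) (u : G) => f₁ u * f₂ (u⁻¹ * g)) := by
    have h1 : (Function.uncurry fun (g : G) (u : G) => f₁ u * f₂ (u⁻¹ * g)) =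
        fun q : G × G => f₁ q.2 * f₂ (q.2⁻¹ * q.1) := by funext q; rfl
    rw [h1]
    exact (hf₁.comp continuous_snd).mul (hf₂.comp (by fun_prop))
  have h := continuous_parametric_integral_of_continuous (μ := ν) hFc hfs₁.isCompact
  have heq : (mulConv ν f₁ f₂) = fun g => ∫ u in tsupport f₁, f₁ u * f₂ (u⁻¹ * g) ∂ν := by
    funext g
    rw [mulConv_apply, setIntegral_eq_integral_of_forall_compl_eq_zero]
    intro u hu
    rw [image_eq_zero_of_notMem_tsupport hu, zero_mul]
  rw [heq]
  exact h

end Convolution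

/-! ### Composition of kernels: `∫_X K_{f₁}(x̃, z) K_{f₂}(z, y) dμ(z) = c K_{f₁ ⋆ f₂}(x̃, y)` -/

section Composition

variable {G : Type*} [Group G] [TopologicalSpace G] [IsTopologicalGroup G] [LocallyCompactSpace G]
  [SecondCountableTopology G] [T2Space G] [MeasurableSpace G] [BorelSpace G]
  (H : Subgroup G) [hH : IsClosed (H : Set G)]
  (ρ : Measure H) [ρ.IsMulLeftInvariant] [ρ.IsMulRightInvariant] [SFinite ρ]
  [IsFiniteMeasureOnCompacts ρ]
  [MeasurableSpace (G ⧸ H)] [BorelSpace (G ⧸ H)]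
  (μ : Measure (G ⧸ H)) [SMulInvariantMeasure G (G ⧸ H) μ] [IsFiniteMeasureOnCompacts μ]
  (ν : Measure G) [IsHaarMeasure ν] [ν.IsInvInvariant]
  {𝕜 : Type*} [RCLike 𝕜]

omit [ρ.IsMulLeftInvariant] [ρ.IsMulRightInvariant] [SFinite ρ] [MeasurableSpace (G ⧸ H)]
  [BorelSpace (G ⧸ H)] [SMulInvariantMeasure G (G ⧸ H) μ] [IsFiniteMeasureOnCompacts μ]
  [ν.IsInvInvariant] in
/-- The integrand `(g, h) ↦ f₁(g) f₂(g⁻¹ x̃ h⁻¹ ỹ⁻¹)` of the composition formula is integrable on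
`G × H` (continuous with compact support `⊆ supp f₁ × (ỹ⁻¹ (supp f₂)⁻¹ (supp f₁)⁻¹ x̃ ∩ H)`).
[folklore] -/
theorem integrable_mul_comp_conj {f₁ f₂ : G → 𝕜} (hf₁ : Continuous f₁)
    (hfs₁ : HasCompactSupport f₁) (hf₂ : Continuous f₂) (hfs₂ : HasCompactSupport f₂) (x₀ y₀ : G) :
    Integrable (Function.uncurry fun (g : G) (h : H) => f₁ g * f₂ (g⁻¹ * x₀ * (h : G)⁻¹ * y₀⁻¹))
      (ν.prod ρ) := by
  haveI : LocallyCompactSpace H := hH.isClosedEmbedding_subtypeVal.locallyCompactSpace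
  have hc : Continuous (Function.uncurry fun (g : G) (h : H) =>
      f₁ g * f₂ (g⁻¹ * x₀ * (h : G)⁻¹ * y₀⁻¹)) := by
    have h1 : (Function.uncurry fun (g : G) (h : H) => f₁ g * f₂ (g⁻¹ * x₀ * (h : G)⁻¹ * y₀⁻¹)) =
        fun q : G × H => f₁ q.1 * f₂ (q.1⁻¹ * x₀ * (q.2 : G)⁻¹ * y₀⁻¹) := by funext q; rfl
    rw [h1]
    exact (hf₁.comp continuous_fst).mul (hf₂.comp (by fun_prop))
  refine hc.integrable_of_hasCompactSupport ?_
  -- compact support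
  set A : Set G := {y₀⁻¹} * (tsupport f₂)⁻¹ * (tsupport f₁)⁻¹ * {x₀} with hA
  have hAc : IsCompact A :=
    (((isCompact_singleton.mul hfs₂.isCompact.inv).mul hfs₁.isCompact.inv).mul isCompact_singleton)
  set S : Set H := ((↑) : H → G) ⁻¹' A with hS
  have hSc : IsCompact S := hH.isClosedEmbedding_subtypeVal.isCompact_preimage hAc
  refine HasCompactSupport.intro (hfs₁.isCompact.prod hSc) fun q hq => ?_
  change f₁ q.1 * f₂ (q.1⁻¹ * x₀ * (q.2 : G)⁻¹ * y₀⁻¹) = 0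
  by_cases h1 : q.1 ∈ tsupport f₁
  · have h2 : q.1⁻¹ * x₀ * (q.2 : G)⁻¹ * y₀⁻¹ ∉ tsupport f₂ := by
      intro hk
      apply hq
      refine Set.mk_mem_prod h1 ?_
      change (q.2 : G) ∈ A
      -- `q.2 = y₀⁻¹ · k⁻¹ · q.1⁻¹ · x₀` with `k = q.1⁻¹ x₀ q.2⁻¹ y₀⁻¹ ∈ supp f₂`
      refine ⟨y₀⁻¹ * (q.1⁻¹ * x₀ * (q.2 : G)⁻¹ * y₀⁻¹)⁻¹ * q.1⁻¹, ?_, x₀, rfl, by group⟩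
      refine Set.mul_mem_mul (Set.mul_mem_mul rfl (Set.inv_mem_inv.2 hk)) (Set.inv_mem_inv.2 h1)
    rw [image_eq_zero_of_notMem_tsupport h2, mul_zero]
  · rw [image_eq_zero_of_notMem_tsupport h1, zero_mul]

/-- **Composition of kernels** (the kernel of `R(f₁) R(f₂) = R(f₁ ⋆ f₂)`; Gelbart (1975), §9:
`R(f₁ * f₂)`, "at least when `f = f₁ * f₂`"). For a compact quotient `X = G ⧸ H` (`G`, `H`
unimodular), `f₁, f₂ ∈ C_c(G)`, every lift `x̃` and every `y ∈ X`:
`∫_X K_{f₁}(x̃, z) K_{f₂}(z, y) dμ(z) = c • K_{f₁ ⋆ f₂}(x̃, y)`, `c = unfoldingConstant H ρ μ ν`.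
Proof: the left side is `c • S_{f₁}(K_{f₂}(·, y))(x̃H)` by the kernel formula of the first layer;
`S_{f₁}(K_{f₂}(·, y))(x̃H) = ∫_G f₁(g) ∫_H f₂(g⁻¹ x̃ h⁻¹ ỹ⁻¹) dρ dν`, and Fubini
(`integrable_mul_comp_conj`) turns this into `∫_H (f₁ ⋆ f₂)(x̃ h⁻¹ ỹ⁻¹) dρ = K_{f₁ ⋆ f₂}(x̃, y)`.
[cite: Gelbart1975, (9.7) and (9.11)] -/
theorem integral_cosetKernel_mul_quotientKernel [CompactSpace (G ⧸ H)] [IsFiniteMeasure μ]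
    {f₁ f₂ : G → 𝕜} (hf₁ : Continuous f₁) (hfs₁ : HasCompactSupport f₁) (hf₂ : Continuous f₂)
    (hfs₂ : HasCompactSupport f₂) (x₀ : G) (y : G ⧸ H) :
    ∫ z, cosetKernel H ρ f₁ x₀ z * quotientKernel H ρ f₂ z y ∂μ =
      (unfoldingConstant H ρ μ ν) • cosetKernel H ρ (mulConv ν f₁ f₂) x₀ y := by
  induction y using QuotientGroup.induction_on with
  | H y₀ =>
    -- the test function `φ = K_{f₂}(·, y)`
    set φ : G ⧸ H → 𝕜 := fun z => quotientKernel H ρ f₂ z (QuotientGroup.mk y₀) with hφ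
    have hφc : Continuous φ :=
      (continuous_uncurry_quotientKernel H ρ hf₂ hfs₂).comp (Continuous.prodMk_left _)
    have hφm : StronglyMeasurable φ := hφc.stronglyMeasurable
    have hφi : Integrable φ μ := by
      obtain ⟨C, hC⟩ := exists_norm_quotientKernel_le H ρ hf₂ hfs₂
      exact (integrable_const C).mono' hφc.aestronglyMeasurable
        (Eventually.of_forall fun z => hC z _)
    -- the kernel formula of the first layer for `f₁` and `φ`
    have h1 := smul_orbitalSmoothing_mk_eq_integral_cosetKernel_smul H ρ μ ν hf₁ hfs₁ hφm hφi x₀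
    simp only [smul_eq_mul] at h1
    rw [← h1, orbitalSmoothing_mk_eq_integral H ν f₁ φ x₀]
    congr 1
    -- `∫_G f₁(x̃ g⁻¹) K_{f₂}(gH, y) dν(g) = K_{f₁ ⋆ f₂}(x̃, y)`: substitute back and use Fubini
    rw [cosetKernel_mk]
    have h2 : (fun g : G => f₁ (x₀ * g⁻¹) • φ (QuotientGroup.mk g)) =
        fun g : G => (fun u : G => ∫ h : H, f₁ u * f₂ (u⁻¹ * x₀ * (h : G)⁻¹ * y₀⁻¹) ∂ρ)
          (x₀ * g⁻¹) := by
      funext g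
      simp only [hφ, quotientKernel_mk_mk, smul_eq_mul]
      rw [← integral_const_mul]
      congr 1 with h
      congr 2
      group
    rw [h2]
    have h3 :
        ∫ g, (fun u : G => ∫ h : H, f₁ u * f₂ (u⁻¹ * x₀ * (h : G)⁻¹ * y₀⁻¹) ∂ρ) (x₀ * g⁻¹) ∂ν =
        ∫ u, ∫ h : H, f₁ u * f₂ (u⁻¹ * x₀ * (h : G)⁻¹ * y₀⁻¹) ∂ρ ∂ν := by
      have e := orbitalSmoothing_mk_eq_integral H ν
        (fun u : G => ∫ h : H, f₁ u * f₂ (u⁻¹ * x₀ * (h : G)⁻¹ * y₀⁻¹) ∂ρ)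
        (fun _ : G ⧸ H => (1 : 𝕜)) x₀
      simp only [orbitalSmoothing, smul_eq_mul, mul_one] at e
      exact e.symm
    rw [h3, integral_integral_swap (integrable_mul_comp_conj H ρ ν hf₁ hfs₁ hf₂ hfs₂ x₀ y₀)]
    congr 1 with h
    rw [mulConv_apply]
    congr 1 with u
    congr 1
    group

omit [IsFiniteMeasureOnCompacts ρ] in
/-- **The kernel of `f^*` is the adjoint kernel**: `K_{f^*}(z, y) = \overline{K_f(y, z)}` on
`X × X`, for `ρ` invariant under inversion (unimodular `H`). [cite: Gelbart1975, Lemma 10.6] -/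
theorem quotientKernel_mulStar [ρ.IsInvInvariant] (f : G → 𝕜) (z y : G ⧸ H) :
    quotientKernel H ρ (mulStar f) z y = starRingEnd 𝕜 (quotientKernel H ρ f y z) := by
  induction z using QuotientGroup.induction_on with
  | H z₀ =>
    induction y using QuotientGroup.induction_on with
    | H y₀ =>
      rw [quotientKernel_mk_mk, quotientKernel_mk_mk, ← integral_conj,
        ← integral_inv_eq_self (fun h : H => starRingEnd 𝕜 (f (y₀ * (h : G)⁻¹ * z₀⁻¹))) ρ]
      congr 1 with h
      rw [mulStar_apply]
      congr 2
      simp only [InvMemClass.coe_inv, mul_inv_rev, inv_inv, mul_assoc]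

/-- **`∬ |K_f|² = c ∫_X K_{f ⋆ f^*}(x, x) dμ(x)`** — the Hilbert–Schmidt norm of the kernel as
the integral of the kernel of `f ⋆ f^*` over the diagonal (Gelbart (1975), (9.11):
`tr R(f) = ∫_{Γ\G} K(x, x) dx` "at least when `f = f₁ * f₂`"; here `R(f)^* R(f)`-form). Compact
quotient, `G` and `H` unimodular, `f ∈ C_c(G)`. [cite: Gelbart1975, (9.11)] -/
theorem integral_integral_norm_sq_quotientKernel [CompactSpace (G ⧸ H)] [IsFiniteMeasure μ]
    [ρ.IsInvInvariant] {f : G → 𝕜} (hf : Continuous f) (hfs : HasCompactSupport f) :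
    (((∫ x, ∫ y, ‖quotientKernel H ρ f x y‖ ^ 2 ∂μ ∂μ : ℝ) : 𝕜)) =
      (unfoldingConstant H ρ μ ν) •
        ∫ x, quotientKernel H ρ (mulConv ν f (mulStar f)) x x ∂μ := by
  rw [NNReal.smul_def, ← integral_smul, ← integral_ofReal]
  refine integral_congr_ae (Eventually.of_forall fun x => ?_)
  induction x using QuotientGroup.induction_on with
  | H x₀ =>
    beta_reduce
    rw [quotientKernel_mk, quotientKernel_mk, ← NNReal.smul_def,
      ← integral_cosetKernel_mul_quotientKernel H ρ μ ν hf hfs (continuous_mulStar hf)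
        (hasCompactSupport_mulStar hfs) x₀ (QuotientGroup.mk x₀), ← integral_ofReal]
    congr 1 with y
    rw [quotientKernel_mulStar, quotientKernel_mk, RCLike.ofReal_pow, RCLike.mul_conj]

end Composition

/-! ### Automorphic quotients: `Σ_i ‖R(f) e_i‖² = c⁻¹ ∫_X K_{f ⋆ f^*}(x, x) dμ(x)` -/

namespace AdelicGroupData

universe u

variable {K : Type} [Field K] [NumberField K] (𝒢 : AdelicGroupData.{u} K)

attribute [local instance] measurableSpaceQuotientForm borelSpaceQuotientForm
  smulInvariantMeasureQuotientForm isFiniteMeasureOnCompactsQuotientForm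

variable (μ : Measure 𝒢.automorphicQuotient) [𝒢.IsAutomorphicMeasure μ]

/-- Finiteness of the automorphic measure, keyed on the syntactic form `G ⧸ H` (it is the field
`IsAutomorphicMeasure.toIsFiniteMeasure`; local instance). [folklore] -/
theorem isFiniteMeasureQuotientForm :
    @IsFiniteMeasure (𝒢.Adelic ⧸ 𝒢.quotientSubgroup) _ μ :=
  IsAutomorphicMeasure.toIsFiniteMeasure

attribute [local instance] isFiniteMeasureQuotientForm

variable [LocallyCompactSpace 𝒢.Adelic] [SecondCountableTopology 𝒢.Adelic] [T2Space 𝒢.Adelic]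
  [MeasurableSpace 𝒢.Adelic] [BorelSpace 𝒢.Adelic]
  [hH : IsClosed (𝒢.quotientSubgroup : Set 𝒢.Adelic)]
  (ρ : Measure 𝒢.quotientSubgroup) [ρ.IsMulLeftInvariant] [ρ.IsMulRightInvariant]
  [ρ.IsInvInvariant] [IsFiniteMeasureOnCompacts ρ] [SFinite ρ]
  (ν : Measure 𝒢.Adelic) [IsHaarMeasure ν] [ν.IsInvInvariant]

/-- **`Σ_i ‖R(f) e_i‖² = c⁻¹ ∫_X K_{f ⋆ f^*}(x, x) dμ(x)`** — the Hilbert–Schmidt norm of `R(f)`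
on `L²` of a compact automorphic quotient as the integral over the diagonal of the (continuous)
kernel of `f ⋆ f^*` (Gelbart (1975), (9.11) with Lemma 10.6: `tr R(f * f^*) = ∫ K_{f*f^*}(x, x)`,
the quantity whose two expressions — spectral and geometric, (9.12)–(9.13), (10.14) — make up the
trace formula for the compact quotient). Hypotheses as in
`hasSum_norm_sq_integratedOperator_rightRegular`, with `ρ` two-sided and inversion invariant
(unimodular `H`, `AdelicGroupDataQuotientUnimodular`). [cite: Gelbart1975, (9.11) and Lemma 10.6] -/
theorem hasSum_norm_sq_integratedOperator_rightRegular_eq_diagonal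
    [CompactSpace 𝒢.automorphicQuotient] (hρ : ρ ≠ 0) (f : C_c(𝒢.Adelic, ℂ)) {ι : Type*}
    [Countable ι] (b : HilbertBasis ι ℂ (𝒢.L2 μ)) :
    HasSum (fun i => ((‖(𝒢.rightRegular μ).integratedOperator (𝒢.isUnitary_rightRegular μ)
        (𝒢.isStronglyContinuous_rightRegular_holds μ) ν f (b i)‖ ^ 2 : ℝ) : ℂ))
      (((unfoldingConstant 𝒢.quotientSubgroup ρ μ ν : ℝ)⁻¹ : ℂ) *
        ∫ x, quotientKernel 𝒢.quotientSubgroup ρ (mulConv ν f (mulStar f)) x x ∂μ) := by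
  haveI : CompactSpace (𝒢.Adelic ⧸ 𝒢.quotientSubgroup) := ‹CompactSpace 𝒢.automorphicQuotient›
  have hc : unfoldingConstant 𝒢.quotientSubgroup ρ μ ν ≠ 0 :=
    (unfoldingConstant_pos 𝒢.quotientSubgroup ρ μ ν (IsAutomorphicMeasure.ne_zero 𝒢 μ) hρ).ne'
  have h := (hasSum_norm_sq_integratedOperator_rightRegular 𝒢 ρ μ ν hρ f b).map
    (Complex.ofRealCLM : ℝ →L[ℝ] ℂ) Complex.continuous_ofReal
  have h2 : (((∫ x : 𝒢.automorphicQuotient, ∫ y : 𝒢.automorphicQuotient,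
      ‖quotientKernel 𝒢.quotientSubgroup ρ f x y‖ ^ 2 ∂μ ∂μ : ℝ) : ℂ)) =
      (unfoldingConstant 𝒢.quotientSubgroup ρ μ ν) • ∫ x : 𝒢.automorphicQuotient,
        quotientKernel 𝒢.quotientSubgroup ρ (mulConv ν f (mulStar f)) x x ∂μ :=
    integral_integral_norm_sq_quotientKernel 𝒢.quotientSubgroup ρ μ ν (𝕜 := ℂ)
      (f := (f : 𝒢.Adelic → ℂ)) f.continuous f.hasCompactSupport
  have h' : HasSum (fun i => ((‖(𝒢.rightRegular μ).integratedOperator (𝒢.isUnitary_rightRegular μ)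
        (𝒢.isStronglyContinuous_rightRegular_holds μ) ν f (b i)‖ ^ 2 : ℝ) : ℂ))
      (((((unfoldingConstant 𝒢.quotientSubgroup ρ μ ν : ℝ)⁻¹) ^ 2 *
        ∫ x, ∫ y, ‖quotientKernel 𝒢.quotientSubgroup ρ f x y‖ ^ 2 ∂μ ∂μ : ℝ) : ℂ)) := h
  have hv : (((((unfoldingConstant 𝒢.quotientSubgroup ρ μ ν : ℝ)⁻¹) ^ 2 *
        ∫ x, ∫ y, ‖quotientKernel 𝒢.quotientSubgroup ρ f x y‖ ^ 2 ∂μ ∂μ : ℝ) : ℂ)) =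
      (((unfoldingConstant 𝒢.quotientSubgroup ρ μ ν : ℝ)⁻¹ : ℂ) *
        ∫ x, quotientKernel 𝒢.quotientSubgroup ρ (mulConv ν f (mulStar f)) x x ∂μ) := by
    have hc' : ((unfoldingConstant 𝒢.quotientSubgroup ρ μ ν : ℝ) : ℂ) ≠ 0 := by
      exact_mod_cast hc
    rw [Complex.ofReal_mul, h2, NNReal.smul_def, Complex.real_smul, ← mul_assoc]
    congr 1
    rw [Complex.ofReal_pow, Complex.ofReal_inv, sq, mul_assoc, inv_mul_cancel₀ hc', mul_one]
  rw [hv] at h'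
  exact h'

end AdelicGroupData

end Literature.NumberTheory.Automorphic
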